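import Mathlib
import HarnessLib
import Summits.Ventures.LatticeQCDFlow.Exactness.NCMCGeneralSpaceSampleSizeVarianceInflation
import Summits.Ventures.LatticeQCDFlow.Exactness.NCMCGeneralSpaceMarkovRun
import Summits.Ventures.LatticeQCDFlow.Exactness.NCMCGeneralSpaceMarkovErgodicCriteria
import Summits.Ventures.LatticeQCDFlow.Scoring.ChainTimeAverage
import Summits.Ventures.LatticeQCDFlow.Scoring.DoeblinSkeleton

/-!
# NCMCGeneralSpaceRestartChainSampleSize — the Jarzynski / reweighting SAMPLE SIZE along the
# engine's RESTART CHAIN: with a level sampler minorised by the equilibrium law (`K(z,·) ≥ ε·π₀`)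
# between launches, `N ≥ exp(E_{P_R}[ΔF − W] + t)` consecutive evolutions give the independent-
# records error with `e^{−t/4}` inflated by `√(2/ε − 1)` — `N_eff = N/(2/ε − 1)`

HONEST FRAMING: exact (Metropolis-corrected) sampling algorithms for lattice gauge theory;
figures of merit are autocorrelation/cost numbers at stated couplings and volumes; no
continuum-physics claim.

Venture `LatticeQCDFlow` (cell pub-lqcd); FANOUT row 19 (`su2-snf`, GEN-8: the `n_between` lever of
the row's family-C protocol — evolutions are launched every `n_between` sweeps of an equilibrium
PRIOR chain, so successive Jarzynski weights are correlated through their starts).  OUR WORK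
(bookkeeping over rows 8 / 11 / 13's kernel-level framework); nothing is cited as a fact.
ASSEMBLY of four tree facts: (1) row 13's equilibrium restart chain of forward records
(`Exactness/NCMCGeneralSpaceMarkovRun`: the `Kernel.trajMeasure` of the restart kernel
`R = (κF ∘ₖ K).comap s` started in `P_F`; every one-record marginal is `P_F`,
`CrooksPair.restartChain_map_eval`); (2) a minorisation of the level sampler by the normalised prior
law, `ε·π₀(B) ≤ K(z, B)` (`π₀ = Z₀⁻¹ν₀`), passes to the restart kernel as `ε·P_F(B) ≤ R(x, B)`
(`minorized_comp_comap`, `Exactness/NCMCGeneralSpaceMarkovErgodicCriteria`); (3) row 11's certified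
error bar for a chain Doeblin-minorised by its own invariant law
(`Scoring/ChainTimeAverage.variance_timeAverage_le_of_doeblin`:
`Var[(1/N)Σ_{i<N} g(Xᵢ)] ≤ (2/ε − 1)·Var_π g/N` for bounded measurable `g`) — i.e. the VARIANCE
INFLATION FACTOR of the restart chain on bounded observables is `C = 2/ε − 1`; (4) this seat's
correlated-records sufficiency law (`Exactness/NCMCGeneralSpaceSampleSizeVarianceInflation`,
Crooks docking, bounded class).

* `chain_firstCoords_map_eval` — the law of the first `N` coordinates of a chain started in an
  invariant law `π`, as a measure on `Fin N → S`, has every one-draw marginal `π`;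
* **`chain_variance_sum_le_of_doeblin`** — for that law and every bounded measurable `g`:
  `Var(Σ_{i<N} g(Xᵢ)) ≤ (2/ε − 1)·N·Var_π g` under `ε·π ≤ κ(x, ·)`, `ε > 0` (row 11's bound × `N²`);
* **`CrooksPair.sampleSize_sufficient_restartChain`** — Crooks pair, `ν₀`-invariant Markov level
  sampler `K` with `ε·π₀(B) ≤ K(z, B)` for all `z` and measurable `B`, `ε > 0`; bounded measurable
  `f`; any real `t`, `N ≥ exp(E_{P_R}[ΔF − W] + t)`.  Along the equilibrium restart chain
  `E|(1/N)Σ_{i<N} f(εᵢ)e^{ΔF − W(εᵢ)} − E_{P_R} f| ≤ ‖f‖_{L²(P_R)}·(√(2/ε − 1)·e^{−t/4} + 2√(P_R{E_{P_R}[ΔF − W] + t/2 < ΔF − W}))`;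
* **`CrooksPair.jarzynski_sampleSize_sufficient_restartChain`** — `f = 1`:
  `E|Ẑ_N·e^{ΔF} − 1| ≤ √(2/ε − 1)·e^{−t/4} + 2√(P_R{…})`, `Ẑ_N = (1/N)Σ_{i<N} e^{−W(εᵢ)}`;
* `CrooksPair.jarzynski_sampleSize_sufficient_restartChain_nHit` — the `n_between` lever typed:
  `K = nHit κ₁ (m+1)` sweeps of a one-sweep-minorised `κ₁` ⇒ the same bound with the same `ε` for
  every `m` (row 8's `Scoring.doeblin_nHit_succ_of_doeblin`, row 9's `invariant_nHit`).

Reading (value-free): the printed independent-evolutions threshold `N ≈ exp D(P̃_R‖P_F)` of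
`Exactness/NCMCGeneralSpaceSampleSize` holds for the restart chain with `N` replaced by
`N/(2/ε − 1)`; `ε = ε(n_between)` is the Doeblin constant of ONE LAUNCH INTERVAL of the prior
sampler (`K = κ₁^{n_between}`, the `m`-skeleton form of row 8's `Scoring/DoeblinSkeleton`; a one-sweep
constant is an `n_between`-sweep constant, `doeblin_nHit_succ_of_doeblin`, and `ε(m)` is
non-decreasing in `m` since `κ₁^{m+1} ≥ ε(m)·π₀κ₁ = ε(m)·π₀`), so the sample-size penalty `2/ε − 1` of
correlated starts does not increase with `n_between` and is `1` for independent launches (`ε = 1`).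
NOT CLAIMED: a Doeblin constant for any concrete heat-bath / over-relaxation sweep; the rate at which
`ε(n_between) → 1`; unbounded `f`; necessity (row 19's `Exactness/NCMCGeneralSpaceSampleSizeMarginals`
covers it with no mixing input at all).
-/

namespace Summit.Ventures.LatticeQCDFlow.Exactness.GeneralNCMC

open MeasureTheory ProbabilityTheory Set Filter Finset
open scoped ENNReal

/-! ## §1 The first `N` coordinates of a stationary Doeblin chain: marginals and variance inflation -/

section Chain

variable {S : Type*} [MeasurableSpace S] (κ : Kernel S S) [IsMarkovKernel κ]
variable {π : Measure S} [IsProbabilityMeasure π]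

/-- The law of the first `N` coordinates of the chain started in an invariant law `π`, pushed to
`Fin N → S`, has one-draw marginals `π`. -/
theorem chain_firstCoords_map_eval (hπ : Kernel.Invariant κ π) (N : ℕ) (i : Fin N) :
    ((Kernel.trajMeasure (X := fun _ : ℕ => S) π
        (fun n : ℕ => κ.comap (fun h : (j : ↥(Finset.Iic n)) → S => h ⟨n, Finset.mem_Iic.2 le_rfl⟩)
          (measurable_pi_apply _))).map (fun (x : ℕ → S) (j : Fin N) => x j)).map (fun y => y i)
      = π := by
  have hr : Measurable (fun (x : ℕ → S) (j : Fin N) => x j) :=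
    measurable_pi_lambda _ fun j => measurable_pi_apply _
  rw [Measure.map_map (measurable_pi_apply i) hr]
  exact chain_map_eval_of_invariant κ hπ i

/-- **VARIANCE INFLATION OF A STATIONARY DOEBLIN CHAIN (bounded class).**  If `ε·π(B) ≤ κ(x, B)`
for every `x` and measurable `B` (`ε > 0`), then for every bounded measurable `g` and every `N`:
`Var(Σ_{i<N} g(Xᵢ)) ≤ (2/ε − 1)·N·Var_π(g)` for the chain started in `π` (row 11's
`variance_timeAverage_le_of_doeblin` times `N²`; `autocov κ π (g − π g) 0 = Var_π g`). -/
theorem chain_variance_sum_le_of_doeblin (hπ : Kernel.Invariant κ π) {ε : ℝ≥0∞}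
    (hmin : ∀ x {B : Set S}, MeasurableSet B → ε * π B ≤ κ x B) (hε0 : 0 < ε)
    {g : S → ℝ} (hg : Measurable g) {B : ℝ} (hB : ∀ x, |g x| ≤ B) (N : ℕ) :
    Var[fun y : Fin N → S => ∑ i, g (y i);
        (Kernel.trajMeasure (X := fun _ : ℕ => S) π
          (fun n : ℕ => κ.comap (fun h : (j : ↥(Finset.Iic n)) → S => h ⟨n, Finset.mem_Iic.2 le_rfl⟩)
            (measurable_pi_apply _))).map (fun (x : ℕ → S) (j : Fin N) => x j)]
      ≤ (2 / ε.toReal - 1) * N * Var[g; π] := by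
  set P := Kernel.trajMeasure (X := fun _ : ℕ => S) π
      (fun n : ℕ => κ.comap (fun h : (j : ↥(Finset.Iic n)) → S => h ⟨n, Finset.mem_Iic.2 le_rfl⟩)
        (measurable_pi_apply _)) with hP
  have hr : Measurable (fun (x : ℕ → S) (j : Fin N) => x j) :=
    measurable_pi_lambda _ fun j => measurable_pi_apply _
  have hsumm : Measurable (fun y : Fin N → S => ∑ i, g (y i)) :=
    Finset.measurable_sum _ fun i _ => hg.comp (measurable_pi_apply i)
  rw [variance_map hsumm.aemeasurable hr.aemeasurable]
  have hcomp : ((fun y : Fin N → S => ∑ i, g (y i)) ∘ fun (x : ℕ → S) (j : Fin N) => x j)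
      = fun x : ℕ → S => ∑ i ∈ range N, g (x i) := by
    funext x
    simp only [Function.comp_apply]
    exact Fin.sum_univ_eq_sum_range (fun i => g (x i)) N
  rw [hcomp]
  -- `autocov κ π (g − π g) 0 = Var_π g`
  have hac : Scoring.autocov κ π (fun y => g y - ∫ z, g z ∂π) 0 = Var[g; π] := by
    rw [Scoring.autocov_zero, variance_eq_integral hg.aemeasurable]
  rcases Nat.eq_zero_or_pos N with hN0 | hNpos
  · subst hN0
    simp only [range_zero, sum_empty, Nat.cast_zero, mul_zero, zero_mul]
    exact (variance_zero P).le
  have hN' : (N : ℝ) ≠ 0 := by exact_mod_cast hNpos.ne'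
  have hmean := Scoring.variance_timeAverage_le_of_doeblin (κ := κ) hπ hmin hε0 hg hB hNpos.ne'
  rw [hac] at hmean
  have hfun : (fun x : ℕ → S => ∑ i ∈ range N, g (x i))
      = fun x : ℕ → S => ((∑ i ∈ range N, g (x i)) / N) * N := by
    funext x; rw [div_mul_cancel₀ _ hN']
  rw [hfun, variance_mul_const]
  calc Var[fun x : ℕ → S => (∑ i ∈ range N, g (x i)) / N; P] * (N : ℝ) ^ 2
      ≤ ((2 / ε.toReal - 1) * Var[g; π] / N) * (N : ℝ) ^ 2 :=
        mul_le_mul_of_nonneg_right hmean (sq_nonneg _)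
    _ = (2 / ε.toReal - 1) * N * Var[g; π] := by field_simp

end Chain

/-! ## §2 The restart chain of a Crooks pair under a minorised level sampler -/

variable {Ω E : Type*} [MeasurableSpace Ω] [MeasurableSpace E]

namespace CrooksPair

variable {ν₀ ν₁ : Measure Ω} {κF κR : Kernel Ω E} {s e : E → Ω} {W : E → ℝ}

/-- **JARZYNSKI / REWEIGHTING SAMPLE SIZE ALONG THE RESTART CHAIN (sufficiency).**  A Crooks pair
(`P_F`, `P_R`, `e^{−ΔF} = Z₁/Z₀`); a Markov level sampler `K` leaving `ν₀` invariant and minorised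
by the normalised prior law, `ε·(Z₀⁻¹ν₀)(B) ≤ K(z, B)` for all `z` and measurable `B`, `ε > 0`; a
bounded measurable `f` (`|f| ≤ B`); any real `t` and `N ≥ exp(E_{P_R}[ΔF − W] + t)`.  Along the
equilibrium restart chain of forward records (record `i+1` launched from `K(s(εᵢ), ·)`):
`E|(1/N)Σ_{i<N} f(εᵢ)e^{ΔF − W(εᵢ)} − E_{P_R} f| ≤ ‖f‖_{L²(P_R)}·(√(2/ε − 1)·e^{−t/4} + 2√(P_R{E_{P_R}[ΔF − W] + t/2 < ΔF − W}))`. -/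
theorem sampleSize_sufficient_restartChain (K : Kernel Ω Ω) [IsMarkovKernel K]
    [IsFiniteMeasure ν₀] [IsFiniteMeasure ν₁] [IsMarkovKernel κF] [IsMarkovKernel κR]
    (h0 : ν₀ univ ≠ 0) (h1 : ν₁ univ ≠ 0) (hK : Kernel.Invariant K ν₀)
    (h : CrooksPair ν₀ ν₁ κF κR s e W) {ΔF : ℝ}
    (hΔF : Real.exp (-ΔF) = ((ν₀ univ)⁻¹ * ν₁ univ).toReal)
    {ε : ℝ≥0∞} (hε0 : 0 < ε)
    (hmin : ∀ z (B : Set Ω), MeasurableSet B → ε * ((ν₀ univ)⁻¹ • ν₀) B ≤ K z B)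
    {f : E → ℝ} (hf : Measurable f) {B : ℝ} (hB : ∀ ε', |f ε'| ≤ B)
    {N : ℕ} {t : ℝ} (hN : Real.exp ((∫ ε', (ΔF - W ε') ∂(fwdPathLaw ν₁ κR)) + t) ≤ N) :
    haveI := isProbabilityMeasure_fwdPathLaw ν₀ h0 κF
    ∫ x, |(1 / (N : ℝ)) * ∑ i ∈ range N, f (x i) * Real.exp (ΔF - W (x i))
          - ∫ ε', f ε' ∂(fwdPathLaw ν₁ κR)|
        ∂(Kernel.trajMeasure (X := fun _ : ℕ => E) (fwdPathLaw ν₀ κF)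
          (fun n : ℕ => ((κF ∘ₖ K).comap s h.measurable_s).comap
            (fun hh : (j : ↥(Finset.Iic n)) → E => hh ⟨n, Finset.mem_Iic.2 le_rfl⟩)
            (measurable_pi_apply _)))
      ≤ Real.sqrt (∫ ε', f ε' ^ 2 ∂(fwdPathLaw ν₁ κR)) *
          (Real.sqrt (2 / ε.toReal - 1) * Real.exp (-t / 4) + 2 * Real.sqrt ((fwdPathLaw ν₁ κR)
            {ε' | (∫ ε'', (ΔF - W ε'') ∂(fwdPathLaw ν₁ κR)) + t / 2 < ΔF - W ε'}).toReal) := by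
  haveI := isProbabilityMeasure_fwdPathLaw ν₀ h0 κF
  set R := (κF ∘ₖ K).comap s h.measurable_s with hR
  set P := Kernel.trajMeasure (X := fun _ : ℕ => E) (fwdPathLaw ν₀ κF)
      (fun n : ℕ => R.comap (fun hh : (j : ↥(Finset.Iic n)) → E => hh ⟨n, Finset.mem_Iic.2 le_rfl⟩)
        (measurable_pi_apply _)) with hP
  have hπ : Kernel.Invariant R (fwdPathLaw ν₀ κF) := h.invariant_restartKernel K hK
  -- the minorisation passes to the restart kernel: `ε P_F ≤ R(x, ·)`
  have hminR : ∀ x {B : Set E}, MeasurableSet B → ε * (fwdPathLaw ν₀ κF) B ≤ R x B := by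
    intro x B hBm
    rw [fwdPathLaw_eq_bind_smul]
    exact minorized_comp_comap K κF h.measurable_s hmin x B hBm
  -- the law of the first `N` records
  have hr : Measurable (fun (x : ℕ → E) (j : Fin N) => x j) :=
    measurable_pi_lambda _ fun j => measurable_pi_apply _
  set Q := P.map (fun (x : ℕ → E) (j : Fin N) => x j) with hQ
  haveI : IsProbabilityMeasure Q := Measure.isProbabilityMeasure_map hr.aemeasurable
  have hmarg : ∀ i : Fin N, Q.map (fun y => y i) = fwdPathLaw ν₀ κF := fun i => by
    rw [hQ, hP]; exact chain_firstCoords_map_eval R hπ N i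
  have hε1 : ε ≤ 1 := Scoring.eps_le_one_of_doeblin hminR
  have hεr0 : 0 < ε.toReal :=
    ENNReal.toReal_pos hε0.ne' (ne_top_of_le_ne_top ENNReal.one_ne_top hε1)
  have hεr : ε.toReal ≤ 1 := by
    have := ENNReal.toReal_mono ENNReal.one_ne_top hε1
    simpa using this
  have hC0 : 0 ≤ 2 / ε.toReal - 1 := by
    rw [sub_nonneg, le_div_iff₀ hεr0]; linarith
  have hvar : ∀ g : E → ℝ, Measurable g → ∀ B' : ℝ, (∀ ε', |g ε'| ≤ B') →
      Var[fun y : Fin N → E => ∑ i, g (y i); Q]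
        ≤ (2 / ε.toReal - 1) * N * Var[g; fwdPathLaw ν₀ κF] := by
    intro g hg B' hB'
    rw [hQ, hP]
    exact chain_variance_sum_le_of_doeblin R hπ hminR hε0 hg hB' N
  have key := h.sampleSize_sufficient_of_varianceInflation_bdd h0 h1 hΔF hf hB Q hmarg hC0 hvar hN
  -- back to the trajectory measure
  have hintm : Measurable (fun y : Fin N → E => |(1 / (N : ℝ)) * ∑ i, f (y i)
      * Real.exp (ΔF - W (y i)) - ∫ ε', f ε' ∂(fwdPathLaw ν₁ κR)|) := by
    have hW := h.measurable_W
    refine Measurable.abs ((measurable_const.mul (Finset.measurable_sum _ fun i _ => ?_)).sub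
      measurable_const)
    exact (hf.comp (measurable_pi_apply i)).mul
      (Real.measurable_exp.comp (measurable_const.sub (hW.comp (measurable_pi_apply i))))
  rw [hQ, integral_map hr.aemeasurable hintm.aestronglyMeasurable] at key
  have hcomp : ∀ x : ℕ → E, (∑ i : Fin N, f (x i) * Real.exp (ΔF - W (x i)))
      = ∑ i ∈ range N, f (x i) * Real.exp (ΔF - W (x i)) := fun x =>
    Fin.sum_univ_eq_sum_range (fun i => f (x i) * Real.exp (ΔF - W (x i))) N
  simp only [hcomp] at key
  exact key

/-- **JARZYNSKI SAMPLE SIZE ALONG THE RESTART CHAIN** (`f = 1`): under the same hypotheses,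
`E|Ẑ_N·e^{ΔF} − 1| ≤ √(2/ε − 1)·e^{−t/4} + 2√(P_R{E_{P_R}[ΔF − W] + t/2 < ΔF − W})`,
`Ẑ_N = (1/N)Σ_{i<N} e^{−W(εᵢ)}` the Jarzynski estimator of `N` consecutive evolutions. -/
theorem jarzynski_sampleSize_sufficient_restartChain (K : Kernel Ω Ω) [IsMarkovKernel K]
    [IsFiniteMeasure ν₀] [IsFiniteMeasure ν₁] [IsMarkovKernel κF] [IsMarkovKernel κR]
    (h0 : ν₀ univ ≠ 0) (h1 : ν₁ univ ≠ 0) (hK : Kernel.Invariant K ν₀)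
    (h : CrooksPair ν₀ ν₁ κF κR s e W) {ΔF : ℝ}
    (hΔF : Real.exp (-ΔF) = ((ν₀ univ)⁻¹ * ν₁ univ).toReal)
    {ε : ℝ≥0∞} (hε0 : 0 < ε)
    (hmin : ∀ z (B : Set Ω), MeasurableSet B → ε * ((ν₀ univ)⁻¹ • ν₀) B ≤ K z B)
    {N : ℕ} {t : ℝ} (hN : Real.exp ((∫ ε', (ΔF - W ε') ∂(fwdPathLaw ν₁ κR)) + t) ≤ N) :
    haveI := isProbabilityMeasure_fwdPathLaw ν₀ h0 κF
    ∫ x, |(1 / (N : ℝ)) * ∑ i ∈ range N, Real.exp (ΔF - W (x i)) - 1|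
        ∂(Kernel.trajMeasure (X := fun _ : ℕ => E) (fwdPathLaw ν₀ κF)
          (fun n : ℕ => ((κF ∘ₖ K).comap s h.measurable_s).comap
            (fun hh : (j : ↥(Finset.Iic n)) → E => hh ⟨n, Finset.mem_Iic.2 le_rfl⟩)
            (measurable_pi_apply _)))
      ≤ Real.sqrt (2 / ε.toReal - 1) * Real.exp (-t / 4) + 2 * Real.sqrt ((fwdPathLaw ν₁ κR)
            {ε' | (∫ ε'', (ΔF - W ε'') ∂(fwdPathLaw ν₁ κR)) + t / 2 < ΔF - W ε'}).toReal := by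
  haveI := isProbabilityMeasure_fwdPathLaw ν₁ h1 κR
  have key := h.sampleSize_sufficient_restartChain K h0 h1 hK hΔF hε0 hmin
    (f := fun _ => (1 : ℝ)) measurable_const (B := 1) (fun _ => by simp) hN
  simp only [one_mul, one_pow, integral_const, probReal_univ, smul_eq_mul, mul_one,
    Real.sqrt_one] at key
  exact key

/-- **THE `n_between` LEVER, TYPED.**  Let the level sampler between launches be `m + 1` sweeps of a
`ν₀`-invariant Markov kernel `κ₁` minorised IN ONE SWEEP by the normalised prior law,
`ε·(Z₀⁻¹ν₀)(B) ≤ κ₁(z, B)` (`ε > 0`).  Then for EVERY `m` the conclusion of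
`jarzynski_sampleSize_sufficient_restartChain` holds with the same `ε` along the restart chain of
`K = nHit κ₁ (m + 1)` (row 9's iterate; a one-sweep constant is an `(m+1)`-sweep constant, row 8's
`Scoring.doeblin_nHit_succ_of_doeblin`): `E|Ẑ_N e^{ΔF} − 1| ≤ √(2/ε − 1)·e^{−t/4} + 2√(P_R-tail)` for
`N ≥ exp(E_{P_R}[ΔF − W] + t)` — more sweeps between launches never worsen the certified `N_eff`. -/
theorem jarzynski_sampleSize_sufficient_restartChain_nHit (κ₁ : Kernel Ω Ω) [IsMarkovKernel κ₁]
    [IsFiniteMeasure ν₀] [IsFiniteMeasure ν₁] [IsMarkovKernel κF] [IsMarkovKernel κR]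
    (h0 : ν₀ univ ≠ 0) (h1 : ν₁ univ ≠ 0) (hK : Kernel.Invariant κ₁ ν₀)
    (h : CrooksPair ν₀ ν₁ κF κR s e W) {ΔF : ℝ}
    (hΔF : Real.exp (-ΔF) = ((ν₀ univ)⁻¹ * ν₁ univ).toReal)
    {ε : ℝ≥0∞} (hε0 : 0 < ε)
    (hmin : ∀ z (B : Set Ω), MeasurableSet B → ε * ((ν₀ univ)⁻¹ • ν₀) B ≤ κ₁ z B) (m : ℕ)
    {N : ℕ} {t : ℝ} (hN : Real.exp ((∫ ε', (ΔF - W ε') ∂(fwdPathLaw ν₁ κR)) + t) ≤ N) :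
    haveI := isProbabilityMeasure_fwdPathLaw ν₀ h0 κF
    haveI := isMarkovKernel_nHit κ₁ (m + 1)
    ∫ x, |(1 / (N : ℝ)) * ∑ i ∈ range N, Real.exp (ΔF - W (x i)) - 1|
        ∂(Kernel.trajMeasure (X := fun _ : ℕ => E) (fwdPathLaw ν₀ κF)
          (fun n : ℕ => ((κF ∘ₖ nHit κ₁ (m + 1)).comap s h.measurable_s).comap
            (fun hh : (j : ↥(Finset.Iic n)) → E => hh ⟨n, Finset.mem_Iic.2 le_rfl⟩)
            (measurable_pi_apply _)))
      ≤ Real.sqrt (2 / ε.toReal - 1) * Real.exp (-t / 4) + 2 * Real.sqrt ((fwdPathLaw ν₁ κR)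
            {ε' | (∫ ε'', (ΔF - W ε'') ∂(fwdPathLaw ν₁ κR)) + t / 2 < ΔF - W ε'}).toReal := by
  haveI := isMarkovKernel_nHit κ₁ (m + 1)
  have hminK : ∀ z (B : Set Ω), MeasurableSet B →
      ε * ((ν₀ univ)⁻¹ • ν₀) B ≤ nHit κ₁ (m + 1) z B :=
    fun z B hB => Scoring.doeblin_nHit_succ_of_doeblin (κ := κ₁) (π := (ν₀ univ)⁻¹ • ν₀)
      (fun x B hB => hmin x B hB) m z hB
  exact h.jarzynski_sampleSize_sufficient_restartChain (nHit κ₁ (m + 1)) h0 h1 (invariant_nHit hK _)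
    hΔF hε0 hminK hN

end CrooksPair

end Summit.Ventures.LatticeQCDFlow.Exactness.GeneralNCMC
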